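import Literature.NumberTheory.Sieve.CFSemigroupTransfer
import HarnessLib

/-!
# A positive eigenfunction of the transfer operator of `Γ_A` (Ruelle–Perron–Frobenius, existence)

Support file (all results proved) for the named fact
`Literature.NumberTheory.Sieve.MageeOhWinter2019_uniformCounting` (`CFSemigroupCounting.lean`).
[MageeOhWinter2019, Thm. 10 (Ruelle–Perron–Frobenius), (2)]: "The maximal eigenvalue of `L_f` is
`e^{P(f)}` which belongs to a unique positive eigenfunction `h_f ∈ L(K)`" (Lipschitz functions).
For the transfer operator `L_s` of the continued fractions semigroup (`cfTransfer`,
`CFSemigroupTransfer.lean`) and its pressure `P_A(s)` (`CFSemigroupPressure.lean`) we PROVE the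
existence statement:

* `exists_cfTransfer_eigenfunction`: for `s ≥ 0` there is a function `h`, Lipschitz on `[0,1]`
  with `4^{-s} ≤ h ≤ 4^s`, such that `L_s h = e^{P_A(s)} h` on `[0,1]`.

The proof is the classical one for positive operators with known growth: the Cesàro means
`h_N = N⁻¹ Σ_{n<N} λ^{-n} L_sⁿ 1` (`λ = e^{P_A(s)}`) are bounded above and below by the Gibbs
bounds `4^{-s} λⁿ ≤ L_sⁿ 1 ≤ 4^s λⁿ` (`cfTransfer_iterate_one_div_mem`), satisfy
`‖L_s h_N - λ h_N‖ ≤ λ (4^s + 1)/N` (`abs_cfTransfer_cfCesaro_sub_le`), and are uniformly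
Lipschitz by bounded distortion (`L_sⁿ 1 (x) ≤ e^{2s|x-y|} L_sⁿ 1 (y)`,
`cfTransfer_iterate_one_le_exp_mul`); Arzelà–Ascoli (Mathlib) gives a uniformly convergent
subsequence, whose limit is the eigenfunction. (Uniqueness and the spectral gap, Thm. 10 (3),
are not treated here.)

## References

* M. Magee, H. Oh, D. Winter, J. reine angew. Math. 753 (2019) 89–135, Thm. 10.
  [MageeOhWinter2019]
* F. Naud, Ann. Sci. ÉNS 38 (2005) 116–153, §2 (RPF for expanding Markov maps).
* W. Parry, M. Pollicott, *Zeta functions and the periodic orbit structure of hyperbolic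
  dynamics*, Astérisque 187–188 (1990), Thm. 2.2.
-/

noncomputable section

open Filter Set
open scoped Topology BoundedContinuousFunction

namespace Literature.NumberTheory.Sieve

variable {A : Finset ℕ} {n : ℕ}

/-! ### Bounded distortion in ratio form -/

/-- `denom(M_w, y) ≤ e^{|x - y|} denom(M_w, x)` for `x, y ∈ [0,1]` (`0 ≤ q' ≤ q ≤ denom`).
[cite: MageeOhWinter2019, §2.1 eq. (2.1)] -/
theorem cfDenom_le_exp_mul {w : Fin n → ℕ} (hw : ∀ i, 1 ≤ w i) {x : ℝ} (hx : x ∈ Icc (0 : ℝ) 1)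
    (y : ℝ) : cfDenom (cfMat w) y ≤ Real.exp |x - y| * cfDenom (cfMat w) x := by
  have hd := one_le_cfExt hw
  have h10 : (0 : ℝ) ≤ (cfMat w 1 0 : ℝ) := by exact_mod_cast cfWord_nonneg _ _ 1 0
  have h10q : (cfMat w 1 0 : ℝ) ≤ (cfMat w 1 1 : ℝ) := by
    have := cfWord_10_le_cfDen hd n
    exact_mod_cast this
  have hden := (cfDenom_cfMat_mem hw hx).1
  have hdenpos := cfDenom_cfMat_pos hw hx
  have hexp : 1 + |x - y| ≤ Real.exp |x - y| := by
    have := Real.add_one_le_exp |x - y|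
    linarith
  have hstep : cfDenom (cfMat w) y ≤ (1 + |x - y|) * cfDenom (cfMat w) x := by
    simp only [cfDenom, cfQ_eq] at hden ⊢
    have habs : (cfMat w 1 0 : ℝ) * (y - x) ≤ (cfMat w 1 0 : ℝ) * |x - y| := by
      rw [abs_sub_comm]
      exact mul_le_mul_of_nonneg_left (le_abs_self _) h10
    nlinarith [abs_nonneg (x - y)]
  exact hstep.trans (mul_le_mul_of_nonneg_right hexp hdenpos.le)

/-- The summands of `L_sⁿ 1` are log-Lipschitz: `(denom(M_w,x)²)^{-s} ≤ e^{2s|x-y|} (denom(M_w,y)²)^{-s}`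
(`s ≥ 0`, `x, y ∈ [0,1]`). [folklore] -/
theorem cfDenom_rpow_le_exp_mul {w : Fin n → ℕ} (hw : ∀ i, 1 ≤ w i) {s : ℝ} (hs : 0 ≤ s)
    {x y : ℝ} (hx : x ∈ Icc (0 : ℝ) 1) (hy : y ∈ Icc (0 : ℝ) 1) :
    ((cfDenom (cfMat w) x) ^ 2) ^ (-s) ≤
      Real.exp (2 * s * |x - y|) * ((cfDenom (cfMat w) y) ^ 2) ^ (-s) := by
  have hax := cfDenom_cfMat_pos hw hx
  have hay := cfDenom_cfMat_pos hw hy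
  have hle := cfDenom_le_exp_mul hw hx y
  -- `den_y² ≤ e^{2|x-y|} den_x²`
  have hsq : (cfDenom (cfMat w) y) ^ 2 ≤ Real.exp (2 * |x - y|) * (cfDenom (cfMat w) x) ^ 2 := by
    have h := pow_le_pow_left₀ hay.le hle 2
    rw [mul_pow, ← Real.exp_nat_mul] at h
    simpa using h
  have h1 := Real.rpow_le_rpow_of_nonpos (pow_pos hay 2) hsq (by linarith : -s ≤ 0)
  rw [Real.mul_rpow (Real.exp_pos _).le (sq_nonneg _), ← Real.exp_mul] at h1
  -- `h1 : e^{-2s|x-y|} (den_x²)^{-s} ≤ (den_y²)^{-s}`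
  have hexp : Real.exp (2 * s * |x - y|) * Real.exp (2 * |x - y| * -s) = 1 := by
    rw [← Real.exp_add]; convert Real.exp_zero using 2; ring
  calc ((cfDenom (cfMat w) x) ^ 2) ^ (-s)
      = Real.exp (2 * s * |x - y|) * (Real.exp (2 * |x - y| * -s) * ((cfDenom (cfMat w) x) ^ 2) ^ (-s)) := by
        rw [← mul_assoc, hexp, one_mul]
    _ ≤ Real.exp (2 * s * |x - y|) * ((cfDenom (cfMat w) y) ^ 2) ^ (-s) :=
        mul_le_mul_of_nonneg_left h1 (Real.exp_pos _).le

/-- **Bounded distortion of the iterates:** `L_sⁿ 1 (x) ≤ e^{2s|x-y|} L_sⁿ 1 (y)` on `[0,1]`.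
[cite: MageeOhWinter2019, §2.1 eq. (2.1)] -/
theorem cfTransfer_iterate_one_le_exp_mul (hA : ∀ a ∈ A, 1 ≤ a) {s : ℝ} (hs : 0 ≤ s) (n : ℕ)
    {x y : ℝ} (hx : x ∈ Icc (0 : ℝ) 1) (hy : y ∈ Icc (0 : ℝ) 1) :
    (cfTransfer A s)^[n] (fun _ => 1) x ≤
      Real.exp (2 * s * |x - y|) * (cfTransfer A s)^[n] (fun _ => 1) y := by
  rw [cfTransfer_iterate hA s _ n hx, cfTransfer_iterate hA s _ n hy, cfTransferSum, cfTransferSum,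
    Finset.mul_sum]
  refine Finset.sum_le_sum fun w _ => ?_
  rw [mul_one, mul_one]
  exact cfDenom_rpow_le_exp_mul (one_le_coe_digit hA w) hs hx hy

/-! ### The Cesàro means -/

variable (A) in
/-- The candidate eigenvalue `λ_s = e^{P_A(s)}`. [cite: MageeOhWinter2019, Thm. 10] -/
def cfEig (s : ℝ) : ℝ := Real.exp (cfPressure A s)

/-- `λ_s > 0`. [folklore] -/
theorem cfEig_pos (s : ℝ) : 0 < cfEig A s := Real.exp_pos _

/-- `λ_sⁿ = e^{n P_A(s)}`. [folklore] -/
theorem cfEig_pow (s : ℝ) (n : ℕ) : cfEig A s ^ n = Real.exp (n * cfPressure A s) := by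
  rw [cfEig, ← Real.exp_nat_mul]

variable (A) in
/-- The Cesàro means `h_N = N⁻¹ Σ_{n<N} λ^{-n} L_sⁿ 1`. [folklore] -/
def cfCesaro (s : ℝ) (N : ℕ) (x : ℝ) : ℝ :=
  (∑ n ∈ Finset.range N, (cfTransfer A s)^[n] (fun _ => 1) x / cfEig A s ^ n) / N

/-- `e^u - 1 ≤ u e^u` (convexity of `exp`). [folklore] -/
private theorem cfExp_sub_one_le_mul_exp (u : ℝ) : Real.exp u - 1 ≤ u * Real.exp u := by
  have h := Real.add_one_le_exp (-u)
  have hpos := Real.exp_pos u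
  have hmul : Real.exp (-u) * Real.exp u = 1 := by rw [← Real.exp_add]; simp
  nlinarith [mul_le_mul_of_nonneg_right h hpos.le]

section Cesaro

variable (hA : ∀ a ∈ A, 1 ≤ a)
include hA

/-- **Gibbs bounds for the normalised iterates:** `4^{-s} ≤ λ^{-n} L_sⁿ 1 (x) ≤ 4^s` on `[0,1]`.
[cite: MageeOhWinter2019, Thm. 10] -/
theorem cfTransfer_iterate_one_div_mem (hne : A.Nonempty) {s : ℝ} (hs : 0 ≤ s) (n : ℕ) {x : ℝ}
    (hx : x ∈ Icc (0 : ℝ) 1) :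
    (cfTransfer A s)^[n] (fun _ => 1) x / cfEig A s ^ n ∈ Icc ((4 : ℝ) ^ (-s)) ((4 : ℝ) ^ s) := by
  have hlam : 0 < cfEig A s ^ n := pow_pos (cfEig_pos s) n
  have h1 := le_cfTransfer_iterate_one hA hs n hx
  have h2 := cfTransfer_iterate_one_le hA hs n hx
  have h3 := exp_mul_cfPressure_le hA hne hs n
  have h4 := cfPartition_le_exp hA hne hs n
  rw [← cfEig_pow] at h3 h4
  have h40 : (0 : ℝ) < (4 : ℝ) ^ (-s) := Real.rpow_pos_of_pos (by norm_num) _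
  constructor
  · rw [le_div_iff₀ hlam]
    nlinarith
  · rw [div_le_iff₀ hlam]
    linarith

/-- `4^{-s} ≤ h_N(x) ≤ 4^s` on `[0,1]` (`N ≥ 1`). [folklore] -/
theorem cfCesaro_mem (hne : A.Nonempty) {s : ℝ} (hs : 0 ≤ s) {N : ℕ} (hN : 0 < N) {x : ℝ}
    (hx : x ∈ Icc (0 : ℝ) 1) :
    cfCesaro A s N x ∈ Icc ((4 : ℝ) ^ (-s)) ((4 : ℝ) ^ s) := by
  have hN' : (0 : ℝ) < N := by exact_mod_cast hN
  rw [cfCesaro]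
  constructor
  · rw [le_div_iff₀ hN']
    calc (4 : ℝ) ^ (-s) * N = ∑ _n ∈ Finset.range N, (4 : ℝ) ^ (-s) := by
          rw [Finset.sum_const, Finset.card_range, nsmul_eq_mul, mul_comm]
      _ ≤ _ := Finset.sum_le_sum fun n _ => (cfTransfer_iterate_one_div_mem hA hne hs n hx).1
  · rw [div_le_iff₀ hN']
    calc ∑ n ∈ Finset.range N, (cfTransfer A s)^[n] (fun _ => 1) x / cfEig A s ^ n
        ≤ ∑ _n ∈ Finset.range N, (4 : ℝ) ^ s :=
          Finset.sum_le_sum fun n _ => (cfTransfer_iterate_one_div_mem hA hne hs n hx).2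
      _ = (4 : ℝ) ^ s * N := by rw [Finset.sum_const, Finset.card_range, nsmul_eq_mul, mul_comm]

omit hA in
/-- The transfer operator applied to a Cesàro mean: `L_s h_N (x) = N⁻¹ Σ_{n<N} λ^{-n} L_s^{n+1} 1 (x)`.
[folklore] -/
theorem cfTransfer_cfCesaro (s : ℝ) (N : ℕ) (x : ℝ) :
    cfTransfer A s (cfCesaro A s N) x =
      (∑ n ∈ Finset.range N, (cfTransfer A s)^[n + 1] (fun _ => 1) x / cfEig A s ^ n) / N := by
  simp only [cfCesaro, cfTransfer, Function.iterate_succ_apply', div_eq_mul_inv, Finset.sum_mul,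
    Finset.mul_sum]
  rw [Finset.sum_comm]
  refine Finset.sum_congr rfl fun n _ => Finset.sum_congr rfl fun a _ => ?_
  ring

/-- **The Cesàro means are almost eigenfunctions:** `|L_s h_N (x) - λ h_N(x)| ≤ λ (4^s + 1)/N` on
`[0,1]` (`N ≥ 1`). [folklore] -/
theorem abs_cfTransfer_cfCesaro_sub_le (hne : A.Nonempty) {s : ℝ} (hs : 0 ≤ s) {N : ℕ} (hN : 0 < N) {x : ℝ}
    (hx : x ∈ Icc (0 : ℝ) 1) :
    |cfTransfer A s (cfCesaro A s N) x - cfEig A s * cfCesaro A s N x| ≤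
      cfEig A s * ((4 : ℝ) ^ s + 1) / N := by
  have hlam := cfEig_pos (A := A) s
  have hN' : (0 : ℝ) < N := by exact_mod_cast hN
  -- telescoping: `Σ_{n<N} λ^{-n} a_{n+1} - λ Σ_{n<N} λ^{-n} a_n = λ (λ^{-N} a_N - a_0)`
  set a : ℕ → ℝ := fun n => (cfTransfer A s)^[n] (fun _ => 1) x with ha
  have hsum : ∑ n ∈ Finset.range N, a (n + 1) / cfEig A s ^ n -
      cfEig A s * ∑ n ∈ Finset.range N, a n / cfEig A s ^ n =
      cfEig A s * (a N / cfEig A s ^ N - a 0) := by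
    have e1 : ∑ n ∈ Finset.range N, a (n + 1) / cfEig A s ^ n =
        cfEig A s * ∑ n ∈ Finset.range N, a (n + 1) / cfEig A s ^ (n + 1) := by
      rw [Finset.mul_sum]
      refine Finset.sum_congr rfl fun n _ => ?_
      rw [pow_succ]
      field_simp
    have tel : ∑ n ∈ Finset.range N, a (n + 1) / cfEig A s ^ (n + 1) -
        ∑ n ∈ Finset.range N, a n / cfEig A s ^ n = a N / cfEig A s ^ N - a 0 := by
      have h1 := Finset.sum_range_succ' (fun n => a n / cfEig A s ^ n) N
      have h2 := Finset.sum_range_succ (fun n => a n / cfEig A s ^ n) N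
      simp only [pow_zero, div_one] at h1
      linarith
    rw [e1, ← mul_sub, tel]
  rw [cfTransfer_cfCesaro, cfCesaro, mul_div_assoc', ← sub_div, hsum, abs_div,
    abs_of_pos hN', abs_mul, abs_of_pos hlam, mul_div_assoc, mul_div_assoc]
  refine mul_le_mul_of_nonneg_left (div_le_div_of_nonneg_right ?_ hN'.le) hlam.le
  have hmem := cfTransfer_iterate_one_div_mem hA hne hs N hx
  have h0 : a 0 = 1 := by simp [ha]
  rw [h0]
  have h40 : (0 : ℝ) < (4 : ℝ) ^ (-s) := Real.rpow_pos_of_pos (by norm_num) _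
  rw [abs_le]
  constructor <;> linarith [hmem.1, hmem.2]

/-- **Log-Lipschitz bound for the Cesàro means:** `h_N(x) ≤ e^{2s|x-y|} h_N(y)` on `[0,1]`.
[folklore] -/
theorem cfCesaro_le_exp_mul {s : ℝ} (hs : 0 ≤ s) (N : ℕ) {x y : ℝ} (hx : x ∈ Icc (0 : ℝ) 1)
    (hy : y ∈ Icc (0 : ℝ) 1) :
    cfCesaro A s N x ≤ Real.exp (2 * s * |x - y|) * cfCesaro A s N y := by
  rw [cfCesaro, cfCesaro, mul_div_assoc', Finset.mul_sum]
  refine div_le_div_of_nonneg_right (Finset.sum_le_sum fun n _ => ?_) (Nat.cast_nonneg N)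
  rw [mul_div_assoc']
  exact div_le_div_of_nonneg_right (cfTransfer_iterate_one_le_exp_mul hA hs n hx hy)
    (pow_pos (cfEig_pos s) n).le

/-- **Uniform Lipschitz bound for the Cesàro means** on `[0,1]`:
`|h_N(x) - h_N(y)| ≤ 4^s · 2s e^{2s} · |x - y|` (`N ≥ 1`). [folklore] -/
theorem abs_cfCesaro_sub_le (hne : A.Nonempty) {s : ℝ} (hs : 0 ≤ s) {N : ℕ} (hN : 0 < N) {x y : ℝ}
    (hx : x ∈ Icc (0 : ℝ) 1) (hy : y ∈ Icc (0 : ℝ) 1) :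
    |cfCesaro A s N x - cfCesaro A s N y| ≤ ((4 : ℝ) ^ s * (2 * s * Real.exp (2 * s))) * |x - y| := by
  have hxy : |x - y| ≤ 1 := by
    rw [abs_le]; constructor <;> linarith [hx.1, hx.2, hy.1, hy.2]
  set u : ℝ := 2 * s * |x - y| with hu
  have hu0 : 0 ≤ u := by rw [hu]; positivity
  have hu1 : u ≤ 2 * s := by rw [hu]; nlinarith [abs_nonneg (x - y)]
  have h1 := cfCesaro_le_exp_mul hA hs N hx hy
  have h2 := cfCesaro_le_exp_mul hA hs N hy hx
  rw [abs_sub_comm y x] at h2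
  have hfx := cfCesaro_mem hA hne hs hN hx
  have hfy := cfCesaro_mem hA hne hs hN hy
  have hE : Real.exp u - 1 ≤ u * Real.exp (2 * s) :=
    (cfExp_sub_one_le_mul_exp u).trans (mul_le_mul_of_nonneg_left (Real.exp_le_exp.2 hu1) hu0)
  have hE0 : 0 ≤ Real.exp u - 1 := by linarith [Real.add_one_le_exp u]
  have h4 : (0 : ℝ) ≤ (4 : ℝ) ^ s := by positivity
  -- `f x - f y ≤ (e^u - 1) f y ≤ (e^u - 1) 4^s` and symmetrically
  rw [← hu] at h1 h2
  rw [abs_le]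
  constructor
  · have : cfCesaro A s N y - cfCesaro A s N x ≤ (Real.exp u - 1) * cfCesaro A s N x := by nlinarith
    have : (Real.exp u - 1) * cfCesaro A s N x ≤ (Real.exp u - 1) * (4 : ℝ) ^ s :=
      mul_le_mul_of_nonneg_left hfx.2 hE0
    nlinarith [mul_le_mul_of_nonneg_right hE h4, abs_nonneg (x - y)]
  · have : cfCesaro A s N x - cfCesaro A s N y ≤ (Real.exp u - 1) * cfCesaro A s N y := by nlinarith
    have : (Real.exp u - 1) * cfCesaro A s N y ≤ (Real.exp u - 1) * (4 : ℝ) ^ s :=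
      mul_le_mul_of_nonneg_left hfy.2 hE0
    nlinarith [mul_le_mul_of_nonneg_right hE h4, abs_nonneg (x - y)]

end Cesaro


/-! ### The eigenfunction -/

section Main

variable (hA : ∀ a ∈ A, 1 ≤ a)
include hA

/-- **Existence of a positive Lipschitz eigenfunction of the transfer operator**
([MageeOhWinter2019, Thm. 10 (2)], existence part, for `Γ_A`): for `s ≥ 0` there is `h` with
`4^{-s} ≤ h ≤ 4^s` and `|h(x) - h(y)| ≤ 4^s · 2s e^{2s} |x - y|` on `[0,1]` such that
`(L_s h)(x) = e^{P_A(s)} h(x)` for all `x ∈ [0,1]`. [cite: MageeOhWinter2019, Thm. 10] -/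
theorem exists_cfTransfer_eigenfunction (hne : A.Nonempty) {s : ℝ} (hs : 0 ≤ s) :
    ∃ h : ℝ → ℝ, (∀ x ∈ Icc (0 : ℝ) 1, h x ∈ Icc ((4 : ℝ) ^ (-s)) ((4 : ℝ) ^ s)) ∧
      (∀ x ∈ Icc (0 : ℝ) 1, ∀ y ∈ Icc (0 : ℝ) 1,
        |h x - h y| ≤ ((4 : ℝ) ^ s * (2 * s * Real.exp (2 * s))) * |x - y|) ∧
      ∀ x ∈ Icc (0 : ℝ) 1, cfTransfer A s h x = cfEig A s * h x := by
  set K : ℝ := (4 : ℝ) ^ s * (2 * s * Real.exp (2 * s)) with hK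
  have hK0 : 0 ≤ K := by rw [hK]; positivity
  -- the Cesàro means restricted to `[0,1]`, as bounded continuous functions
  have hcont : ∀ N : ℕ, Continuous fun x : Icc (0 : ℝ) 1 => cfCesaro A s (N + 1) x := by
    intro N
    have hL : LipschitzOnWith K.toNNReal (cfCesaro A s (N + 1)) (Icc 0 1) := by
      refine LipschitzOnWith.of_dist_le_mul fun x hx y hy => ?_
      rw [Real.dist_eq, Real.dist_eq, Real.coe_toNNReal _ hK0]
      exact abs_cfCesaro_sub_le hA hne hs (Nat.succ_pos N) hx hy
    exact hL.continuousOn.restrict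
  let F : ℕ → (Icc (0 : ℝ) 1 →ᵇ ℝ) := fun N =>
    BoundedContinuousFunction.mkOfCompact ⟨fun x => cfCesaro A s (N + 1) x, hcont N⟩
  have hF : ∀ (N : ℕ) (x : Icc (0 : ℝ) 1), F N x = cfCesaro A s (N + 1) x := fun N x => rfl
  -- Arzelà–Ascoli: the closure of the range of `F` is compact
  have hcomp : IsCompact (closure (range F)) := by
    refine BoundedContinuousFunction.arzela_ascoli (Icc ((4 : ℝ) ^ (-s)) ((4 : ℝ) ^ s))
      isCompact_Icc (range F) ?_ ?_
    · rintro f x ⟨N, rfl⟩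
      rw [hF]
      exact cfCesaro_mem hA hne hs (Nat.succ_pos N) x.2
    · refine Metric.equicontinuous_of_continuity_modulus (fun t => K * t) ?_ _ ?_
      · have h : Tendsto (fun t : ℝ => K * t) (𝓝 0) (𝓝 (K * 0)) :=
          tendsto_const_nhds.mul tendsto_id
        rwa [mul_zero] at h
      · rintro x y ⟨f, N, rfl⟩
        show dist (F N x) (F N y) ≤ K * dist x y
        rw [hF, hF, Real.dist_eq, Subtype.dist_eq, Real.dist_eq]
        exact abs_cfCesaro_sub_le hA hne hs (Nat.succ_pos N) x.2 y.2
  obtain ⟨g, -, φ, hφ, hlim⟩ :=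
    hcomp.tendsto_subseq fun N => subset_closure (mem_range_self N)
  -- pointwise convergence along the subsequence
  have hpt : ∀ x : Icc (0 : ℝ) 1,
      Tendsto (fun k => cfCesaro A s (φ k + 1) x) atTop (𝓝 (g x)) := by
    intro x
    have h := ((continuous_eval_const x).tendsto g).comp hlim
    refine h.congr fun k => ?_
    simp only [Function.comp_apply, hF]
  refine ⟨Set.IccExtend zero_le_one g, ?_, ?_, ?_⟩
  · intro x hx
    rw [Set.IccExtend_of_mem _ _ hx]
    exact isClosed_Icc.mem_of_tendsto (hpt ⟨x, hx⟩)
      (Eventually.of_forall fun k => cfCesaro_mem hA hne hs (Nat.succ_pos _) hx)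
  · intro x hx y hy
    rw [Set.IccExtend_of_mem _ _ hx, Set.IccExtend_of_mem _ _ hy]
    have hlim2 : Tendsto (fun k => |cfCesaro A s (φ k + 1) x - cfCesaro A s (φ k + 1) y|) atTop
        (𝓝 |g ⟨x, hx⟩ - g ⟨y, hy⟩|) := ((hpt ⟨x, hx⟩).sub (hpt ⟨y, hy⟩)).abs
    exact le_of_tendsto' hlim2 fun k => abs_cfCesaro_sub_le hA hne hs (Nat.succ_pos _) hx hy
  · intro x hx
    have hy : ∀ a ∈ A, 1 / (x + a) ∈ Icc (0 : ℝ) 1 := fun a ha => one_div_add_mem_Icc (hA a ha) hx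
    -- `L_s h_{φ k + 1}(x) → L_s H (x)` (finite sum of pointwise limits)
    have hLlim : Tendsto (fun k => cfTransfer A s (cfCesaro A s (φ k + 1)) x) atTop
        (𝓝 (cfTransfer A s (Set.IccExtend zero_le_one g) x)) := by
      simp only [cfTransfer]
      refine tendsto_finsetSum _ fun a ha => ?_
      rw [Set.IccExtend_of_mem _ _ (hy a ha)]
      exact (hpt ⟨_, hy a ha⟩).const_mul _
    -- `λ h_{φ k + 1}(x) → λ H(x)`
    have hRlim : Tendsto (fun k => cfEig A s * cfCesaro A s (φ k + 1) x) atTop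
        (𝓝 (cfEig A s * Set.IccExtend zero_le_one g x)) := by
      rw [Set.IccExtend_of_mem _ _ hx]
      exact (hpt ⟨x, hx⟩).const_mul _
    -- the defect tends to `0`
    have hdiff : Tendsto (fun k => cfTransfer A s (cfCesaro A s (φ k + 1)) x -
        cfEig A s * cfCesaro A s (φ k + 1) x) atTop (𝓝 0) := by
      refine squeeze_zero_norm
        (a := fun k => cfEig A s * ((4 : ℝ) ^ s + 1) / ((φ k + 1 : ℕ) : ℝ)) (fun k => ?_) ?_
      · rw [Real.norm_eq_abs]
        exact abs_cfTransfer_cfCesaro_sub_le hA hne hs (Nat.succ_pos _) hx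
      · have hφ' : Tendsto (fun k => ((φ k + 1 : ℕ) : ℝ)) atTop atTop :=
          tendsto_natCast_atTop_atTop.comp ((tendsto_add_atTop_nat 1).comp hφ.tendsto_atTop)
        exact tendsto_const_nhds.div_atTop hφ'
    have h0 := tendsto_nhds_unique (hLlim.sub hRlim) hdiff
    linarith

end Main

end Literature.NumberTheory.Sieve
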